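import Summits.BirchSwinnertonDyer.Rank1Residual.Additive.XGordRankZeroCyclotomicThreeLower
import Summits.BirchSwinnertonDyer.Rank1Residual.Additive.QuadraticBaseChangeTamagawaCanonicalModelOddPrime
import HarnessLib

/-!
# The LOWER twin of line V14 at `p = 3` over `K = ℚ(ζ₃)`, rank `(0,0)` — ord₃ form: Milne's A73 read
# ONLY through the `3`-adic valuation of the card identity, then PROVED AWAY with NO local-population
# hypothesis (cell `b2b-bsdres`, team n1011, seat p16 GEN 8/9 core, GEN 10/11 `_noLocal`; row T-MIL-CAN,
# consumer twin of `XGordRankZeroCyclotomicThreeLower`; lead R5-87 (e) (W1), additive-p4 GEN 23 word)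

HONEST FRAMING (cell `b2b-bsdres`, run/shared/lean/b2b/bsd-rank1-residual/, verbatim in every
file): the goal of the cell is to DELETE the COMBINATION-SHAPED residual classes of the
Birch–Swinnerton-Dyer formula for ALL analytic-rank `≤ 1` elliptic curves over `ℚ` — "full BSD
formula for every rank `≤ 1` curve in class `C`" assembled STRICTLY from published theorems — so
that the rank-`≤ 1` remainder becomes exactly the CONSTRUCTION-SHAPED classes, which are TYPED
(missing-input `Prop`s), NOT attempted. This is not "finishing BSD". Team n1011 (N10 / N11), seat p16:
research route; X3 / X4 / N10 / N11 labels and marks UNCHANGED; nothing booked. Theorems only.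

`XGordCyclotomicThreeLower.exists_padicVal_shaAn_add_le` (p16 gen 2; THE RESIDUAL INPUT `hLowK` =
two-branch IMC containment over `ℚ(ζ₃)`, not in print) takes Milne 1972 as the WHOLE named fact A73
(`hMilne`) and READS from it only (i) `Ш(V_K)` finite and (ii) the `3`-adic valuation of the card
identity `C(V⊗K)·#Ш(V_K)·#V(ℚ)²·#W(ℚ)² = n_V·|u_C|·#Ш(V)·#Ш(W)·∏c(V)·∏c(W)·#V(K)²`. Lead R5-74 (e) made
literal: `…_of_padicValIdentity` REPLACES `hMilne` by (`hshaK`, `hWR₃`) (proof = the gen-2 chain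
verbatim); `…_noLocal` then DISCHARGES both with NO local-population hypothesis: `Ш(V_K)` finite from
`shaFinite_baseChange_of_twist` and the card identity from T-MIL-CAN FILE 4
`padicVal_card_identity_baseChange_of_natAbs_discr_eq` (`|d_K| = 3`, `V` good at `3`: the per-place
fibre identities (T) hold at EVERY place — n1011-p01's T-MIL-3 H-5a with rows T-MIL-B2 and T-A233
inside), so `hMilne` DISAPPEARS with nothing added. HONEST LIMITS: `hLowK` untouched (NOT in print);
nothing booked; no mark moves. References: as in `XGordRankZeroCyclotomicThreeLower`; Milne 1972 §1.
-/

noncomputable section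

open scoped Classical MatrixGroups ModularForm

open CongruenceSubgroup WeierstrassCurve NumberField IsDedekindDomain Rat.HeightOneSpectrum
  Literature.NumberTheory.EllipticCurves Literature.NumberTheory.EllipticCurves.ModularForms
  Literature.NumberTheory.EllipticCurves.Rank1Residual
  Literature.NumberTheory.EllipticCurves.Rank1Residual.Typed
  Literature.NumberTheory.GaloisRepresentations

namespace Summit.BirchSwinnertonDyer.Rank1Residual.Additive

section Core

variable (K : Type) [Field K] [NumberField K] [IsCyclotomicExtension {3} ℚ K]
  (V : WeierstrassCurve ℚ) [V.IsElliptic] [V.IsGloballyMinimal]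
  (W : WeierstrassCurve ℚ) [W.IsElliptic] [W.IsGloballyMinimal]

/-- **LOWER twin of line V14, rank `(0,0)`, ord₃ form.** As
`XGordCyclotomicThreeLower.exists_padicVal_shaAn_add_le`, with Milne's A73 (`hMilne`) REPLACED by what
that proof reads from it: `hshaK` (`Ш(V_K)` finite) and `hWR₃`, the `3`-adic valuation of the card
identity `C(V⊗K)·#Ш(V_K)·#V(ℚ)²·#W(ℚ)² = n_V·|u_C|·#Ш(V)·#Ш(W)·∏c(V)·∏c(W)·#V(K)²`; conclusion unchanged.
THE RESIDUAL INPUT `hLowK` (two-branch IMC containment over `ℚ(√−3)`, NOT in print) is untouched.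
[cite: GreenbergLNM1716, Thm. 4.1 (p. 102)] [cite: MazurTateTeitelbaum1986Invent, §I.14]
[cite: Milne1972ArithmeticAV, §1 Thm. 1] [cite: Kato2004Asterisque, Thm. 17.4 (p. 273) (torsion clause)] -/
theorem XGordCyclotomicThreeLower.exists_padicVal_shaAn_add_le_of_padicValIdentity
    (hGZK : rank_eq_analyticRank_of_analyticRank_le_one) (hmod : hasEntireLFunction_rat)
    (C : VariableChange ℚ) (hC : C • V.quadraticTwist (-(3 : ℚ)) = W)
    (hshaK : (V.baseChange K).ShaFinite)
    (hWR₃ : padicValRat 3 ((V.baseChange K).modifiedTamagawaProduct * (V.baseChange K).shaOrder *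
        (Nat.card V.toAffine.Point) ^ 2 * (Nat.card W.toAffine.Point) ^ 2 : ℚ) =
      padicValRat 3 ((V.baseChange ℝ).numRealComponents * |(C.u : ℚ)| * V.shaOrder * W.shaOrder *
        V.tamagawaProduct * W.tamagawaProduct * (Nat.card (V.baseChange K).toAffine.Point) ^ 2 : ℚ))
    (hord : IsOrdinaryAt V 3) (hadd : Addv W 3)
    (hrV : V.analyticRank = 0) (hrW : W.analyticRank = 0)
    {N : ℕ} [NeZero N] {f : CuspForm (Gamma0 N) 2} (hf : IsNewformOf V f)
    (ϖ ϖ' : ℚ) (hϖ : (ϖ : ℝ) * V.realPeriodRat = plusPeriod f)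
    (hϖ' : (ϖ' : ℝ) * V.imaginaryPeriodRat = minusPeriod f)
    (hexK : ∃ κ : ZpExtension K 3, κ.IsCyclotomic ∧ ∃ γ : Field.absoluteGaloisGroup K,
      κ.IsTopGenerator γ ∧ ∃ ζ : ℤ_[3]ˣ, IsOfFinOrder ζ ∧
        ((GaloisRep.cyclotomicCharacter K 3 γ * ζ : ℤ_[3]ˣ) : ℤ_[3]) = (cyclotomicGenerator 3 : ℤ_[3]))
    (hTorK : ∀ (κ : ZpExtension K 3) (γ : Field.absoluteGaloisGroup K),
      κ.IsCyclotomic → κ.IsTopGenerator γ →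
      (∃ ζ : ℤ_[3]ˣ, IsOfFinOrder ζ ∧
        ((GaloisRep.cyclotomicCharacter K 3 γ * ζ : ℤ_[3]ˣ) : ℤ_[3]) = (cyclotomicGenerator 3 : ℤ_[3])) →
      ∀ D : (V.baseChange K).SelmerDualData κ γ, D.IsTorsion)
    (hLowK : ∀ (κ : ZpExtension K 3) (γ : Field.absoluteGaloisGroup K),
      κ.IsCyclotomic → κ.IsTopGenerator γ →
      (∃ ζ : ℤ_[3]ˣ, IsOfFinOrder ζ ∧
        ((GaloisRep.cyclotomicCharacter K 3 γ * ζ : ℤ_[3]ˣ) : ℤ_[3]) = (cyclotomicGenerator 3 : ℤ_[3])) →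
      ∀ D : (V.baseChange K).SelmerDualData κ γ, ∀ g ∈ D.charIdeal, ∃ h : IwasawaAlgebra 3,
        iwasawaToPowerSeries 3 g =
          iwasawaToPowerSeries 3 h *
            (PowerSeries.C ((ϖ : ℚ_[3]) * (ϖ' : ℚ_[3])) *
              (padicLFunction f ((unitRoot V 3 : ℤ_[3]) : ℚ_[3]) *
                padicLFunctionMinusBranch f ((unitRoot V 3 : ℤ_[3]) : ℚ_[3]) 1)))
    (hGrK : ∀ (κ : ZpExtension K 3) (γ : Field.absoluteGaloisGroup K),
        κ.IsCyclotomic → κ.IsTopGenerator γ →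
      ∀ (D : (V.baseChange K).SelmerDualData κ γ) [Module.Finite (IwasawaAlgebra 3) D.X], D.IsTorsion →
      ∀ (fE : IwasawaAlgebra 3), D.charIdeal = Ideal.span {fE} →
        Finite ((V.baseChange K).selmerGroupPInfty 3) →
        ∃ u : ℤ_[3]ˣ,
          ((PowerSeries.constantCoeff fE : ℤ_[3]) : ℚ_[3]) *
              (Nat.card (AddCommGroup.primaryComponent (V.baseChange K).toAffine.Point 3) : ℚ_[3]) ^ 2 =
            ((u : ℤ_[3]) : ℚ_[3]) * (3 : ℚ_[3]) ^ (padicValNat 3 (V.baseChange K).tamagawaProduct) *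
              (Nat.card (AddCommGroup.primaryComponent
                ((integralModelInt V).map (Int.castRingHom (ZMod 3))).toAffine.Point 3) : ℚ_[3]) ^ 2 *
              (Nat.card ((V.baseChange K).selmerGroupPInfty 3) : ℚ_[3]))
    (hD1 : PowerSeries.constantCoeff (padicLFunctionMinusBranch f ((unitRoot V 3 : ℤ_[3]) : ℚ_[3]) 1) =
      (((unitRoot V 3 : ℤ_[3]) : ℚ_[3]))⁻¹ * (legendreMinusSymbolSum f 3 : ℚ_[3])) :
    ∃ qV qW : ℚ, shaAn V = (qV : ℂ) ∧ shaAn W = (qW : ℂ) ∧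
      padicValRat 3 qV + padicValRat 3 qW ≤ (padicValNat 3 V.shaOrder : ℤ) + padicValNat 3 W.shaOrder := by
  classical
  set p : ℕ := 3 with hp3
  have h2 : Module.finrank ℚ K = 2 := finrank_eq_two_of_isCyclotomicExtension_three (K := K)
  have hdK : (NumberField.discr K : ℚ) = -(3 : ℚ) := by
    rw [discr_cyclotomicThree K]; norm_num
  haveI : IsTotallyComplex K := isTotallyComplex_cyclotomicThree K
  have hC' : C • V.quadraticTwist (NumberField.discr K : ℚ) = W := by rw [hdK]; exact hC
  -- rank 0: `L(·,1) ≠ 0`, Mordell–Weil groups and `Ш` finite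
  have hLV : V.entireLFunction 1 ≠ 0 := (V.analyticRank_eq_zero_iff_holds (hmod V)).mp hrV
  have hLW : W.entireLFunction 1 ≠ 0 := (W.analyticRank_eq_zero_iff_holds (hmod W)).mp hrW
  obtain ⟨hmwV, hfinV⟩ := hGZK V (by rw [hrV]; exact zero_le_one)
  obtain ⟨hmwW, hfinW⟩ := hGZK W (by rw [hrW]; exact zero_le_one)
  haveI : Finite V.sha := hfinV
  haveI : Finite W.sha := hfinW
  haveI hEV : Finite V.toAffine.Point := V.finite_point_of_rank_zero (by rw [hmwV, hrV])
  haveI hEW : Finite W.toAffine.Point := W.finite_point_of_rank_zero (by rw [hmwW, hrW])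
  -- the canonical `K`-model `V ⊗ K`: finiteness (`Ш(V_K)` finite is the hypothesis `hshaK`)
  set VK := V.baseChange K with hVK
  haveI hEK : Finite VK.toAffine.Point := finite_point_baseChange_of_twist K V W h2 hC'
  haveI : Finite VK.sha := hshaK
  haveI : Finite (AddCommGroup.primaryComponent VK.sha p) :=
    Finite.of_injective _ Subtype.val_injective
  have hSelfin : Finite (VK.selmerGroupPInfty p) :=
    (VK.finite_selmerGroupPInfty_iff p).mpr ⟨hEK, inferInstance⟩
  -- the cyclotomic setting over `K`, the Iwasawa module `X(V/K_∞)`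
  obtain ⟨κ, hκ, γ, hγ, hγ'⟩ := hexK
  obtain ⟨D⟩ := VK.nonempty_selmerDualData_holds κ γ hγ
  haveI : Module.Finite (IwasawaAlgebra p) D.X :=
    (SelmerDualData.module_finite_of_isCyclotomic (W := VK) (κ := κ) hκ D) hγ
  -- [A] torsion (Kato / Wuthrich over `K`) and a generator `fE` of the characteristic ideal
  have hX : D.IsTorsion := hTorK κ γ hκ hγ hγ' D
  haveI : (Module.charIdeal (IwasawaAlgebra p) D.X).IsPrincipal := charIdeal_isPrincipal_holds p D.X
  obtain ⟨fE, hchar⟩ := Submodule.IsPrincipal.principal (Module.charIdeal (IwasawaAlgebra p) D.X)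
  have hchar' : D.charIdeal = Ideal.span {fE} := hchar
  have hfEmem : fE ∈ D.charIdeal := by rw [hchar']; exact Ideal.mem_span_singleton_self fE
  -- [⊇/K] the residual input at the generator: `ι fE = ι h · ϖϖ' · L₃(V,ω⁰,T) · L₃(V,ω¹,T)`
  obtain ⟨h, hιfE⟩ := hLowK κ γ hκ hγ hγ' D fE hfEmem
  -- [Greenberg over `K`]
  obtain ⟨u₁, hu₁⟩ := hGrK κ γ hκ hγ D hX fE hchar' hSelfin
  -- the analytic side over `ℚ` for `V`: `t_V = ϖ [0]⁺_f = L(V,1)/Ω_V`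
  set sV : ℚ := ratPlusSymbol f 0 with hsV
  set tV : ℚ := ϖ * sV with htV
  have hΩV : (V.realPeriodRat : ℂ) ≠ 0 := by exact_mod_cast V.realPeriodRat_pos_holds.ne'
  have hLvalV : V.entireLFunction 1 = (((sV : ℝ) * plusPeriod f : ℝ) : ℂ) := hf.entireLFunction_one_eq
  have hqV' : V.entireLFunction 1 / (V.realPeriodRat : ℂ) = ((tV : ℚ) : ℂ) := by
    rw [hLvalV, ← hϖ, div_eq_iff hΩV, htV]
    push_cast
    ring
  have htV0 : tV ≠ 0 := by
    intro h0
    apply hLV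
    have := (div_eq_iff hΩV).mp hqV'
    rw [this, h0]
    simp
  obtain ⟨-, -, -, hshaV⟩ := Wuthrich2014.shaAn_eq_of_L_one_div_eq hGZK V hLV hqV'
  -- the analytic side over `ℚ` for `W`: odd Birch + Pal
  obtain ⟨ε, hε, hLW_eq⟩ :=
    entireLFunction_one_eq_of_twist_neg 3 hmod (by norm_num) V W C hC hadd hf ϖ' hϖ'
  set S : ℚ := legendreMinusSymbolSum f 3 with hS
  set cinf : ℕ := (W.baseChange ℝ).numRealComponents with hcinf
  set tW : ℚ := ε * (ϖ' * S) / (|(C.u : ℚ)| * (cinf : ℚ)) with htW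
  have hΩW : (W.realPeriodRat : ℂ) ≠ 0 := by exact_mod_cast W.realPeriodRat_pos_holds.ne'
  have hqW' : W.entireLFunction 1 / (W.realPeriodRat : ℂ) = (tW : ℂ) := by
    rw [hLW_eq, mul_div_cancel_right₀ _ hΩW]
  obtain ⟨-, -, -, hshaW⟩ := Wuthrich2014.shaAn_eq_of_L_one_div_eq hGZK W hLW hqW'
  have hua0 : |(C.u : ℚ)| ≠ 0 := abs_ne_zero.mpr C.u.ne_zero
  have hcinf0 : (cinf : ℚ) ≠ 0 := by
    rw [hcinf, numRealComponents]
    split_ifs <;> norm_num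
  have hden0 : |(C.u : ℚ)| * (cinf : ℚ) ≠ 0 := mul_ne_zero hua0 hcinf0
  have hϖS : ϖ' * S ≠ 0 := by
    intro h0
    apply hLW
    rw [hLW_eq, htW, h0, mul_zero, zero_div, Rat.cast_zero, zero_mul]
  have hε0 : ε ≠ 0 := by rcases hε with h | h <;> rw [h] <;> norm_num
  have htW0 : tW ≠ 0 := by
    rw [htW]
    exact div_ne_zero (mul_ne_zero hε0 hϖS) hden0
  have hvε : padicValRat 3 ε = 0 := by
    rcases hε with h | h
    · rw [h, padicValRat.one]
    · rw [h, padicValRat.neg, padicValRat.one]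
  have hvtW : padicValRat 3 tW = padicValRat 3 (ϖ' * S) - padicValRat 3 |(C.u : ℚ)| := by
    rw [htW, padicValRat.div (mul_ne_zero hε0 hϖS) hden0, padicValRat.mul hε0 hϖS,
      padicValRat.mul hua0 hcinf0, hvε, padicValRat_numRealComponents_eq_zero W 3 (by norm_num)]
    ring
  set a : ℚ_[3] := ((unitRoot V 3 : ℤ_[3]) : ℚ_[3]) with ha
  obtain ⟨-, hunit⟩ := unitRoot_spec_holds V 3 hord
  obtain ⟨ua, hua⟩ := hunit
  have haU : a = ((ua : ℤ_[3]) : ℚ_[3]) := by rw [ha, hua]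
  have ha0 : a ≠ 0 := by rw [haU]; exact coe_units_ne_zero 3 ua
  have hL0 : PowerSeries.constantCoeff (padicLFunction f a) = (1 - a⁻¹) ^ 2 * (sV : ℚ_[3]) := by
    rw [ha]
    exact constantCoeff_padicLFunction_unitRoot hord hf
  set h0 : ℚ_[3] := ((PowerSeries.constantCoeff h : ℤ_[3]) : ℚ_[3]) with hh0
  have hfE0 : ((PowerSeries.constantCoeff fE : ℤ_[3]) : ℚ_[3]) =
      h0 * (a⁻¹ * (1 - a⁻¹) ^ 2 * ((tV : ℚ) : ℚ_[3]) * ((ϖ' * S : ℚ) : ℚ_[3])) := by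
    rw [← constantCoeff_iwasawaToPowerSeries 3 fE, hιfE]
    simp only [map_mul, PowerSeries.constantCoeff_C, hL0, hD1, htV, hh0,
      constantCoeff_iwasawaToPowerSeries]
    push_cast
    ring
  -- the anomalous factor: `1 - a⁻¹ = u₂ · #Ẽ(𝔽₃) = u₂ u₃ · #Ẽ(𝔽₃)[3^∞]`
  obtain ⟨u₂, hu₂⟩ := exists_unit_one_sub_unitRoot_inv 3 V hord
  obtain ⟨u₃, hu₃⟩ := exists_unit_natCard_eq_mul_card_primaryComponent
    ((integralModelInt V).map (Int.castRingHom (ZMod 3))).toAffine.Point 3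
  set Np : ℚ_[3] := (Nat.card (AddCommGroup.primaryComponent
    ((integralModelInt V).map (Int.castRingHom (ZMod 3))).toAffine.Point 3) : ℚ_[3]) with hNp
  have hNcount : (V.reductionPointCount 3 : ℚ_[3]) = ((u₃ : ℤ_[3]) : ℚ_[3]) * Np := by
    rw [WeierstrassCurve.reductionPointCount, hNp]
    exact hu₃
  have hNp0 : Np ≠ 0 := by
    rw [hNp]
    exact_mod_cast Nat.card_pos.ne'
  have h1 : (1 - a⁻¹) = ((u₂ : ℤ_[3]) : ℚ_[3]) * ((u₃ : ℤ_[3]) : ℚ_[3]) * Np := by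
    rw [ha, hu₂, hNcount, mul_assoc]
  set TK : ℚ_[3] := (Nat.card (AddCommGroup.primaryComponent VK.toAffine.Point 3) : ℚ_[3]) with hTK
  set ShK : ℚ_[3] := (Nat.card (AddCommGroup.primaryComponent VK.sha 3) : ℚ_[3]) with hShK
  set vK : ℕ := padicValNat 3 VK.tamagawaProduct with hvK
  have hSelK : (Nat.card (VK.selmerGroupPInfty 3) : ℚ_[3]) = ShK := by
    rw [hShK, VK.natCard_selmerGroupPInfty_eq_natCard_primaryComponent_sha 3]
  have hTK0 : TK ≠ 0 := by rw [hTK]; exact_mod_cast Nat.card_pos.ne'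
  have hShK0 : ShK ≠ 0 := by rw [hShK]; exact_mod_cast Nat.card_pos.ne'
  have hp0 : (3 : ℚ_[3]) ≠ 0 := by exact_mod_cast (by norm_num : (3 : ℕ) ≠ 0)
  have hh0val : 0 ≤ h0.valuation := by
    rw [hh0]
    exact PadicInt.valuation_coe_nonneg
  have htVQ : ((tV : ℚ) : ℚ_[3]) ≠ 0 := by exact_mod_cast htV0
  have hϖSQ : ((ϖ' * S : ℚ) : ℚ_[3]) ≠ 0 := by exact_mod_cast hϖS
  set UU : ℚ_[3] := a⁻¹ * (((u₂ : ℤ_[3]) : ℚ_[3]) * ((u₃ : ℤ_[3]) : ℚ_[3])) ^ 2 with hUU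
  have hUU0 : UU ≠ 0 :=
    mul_ne_zero (inv_ne_zero ha0)
      (pow_ne_zero 2 (mul_ne_zero (coe_units_ne_zero 3 u₂) (coe_units_ne_zero 3 u₃)))
  -- KEY: `h(0) · (α⁻¹ (u₂u₃)²) · (t_V · (ϖ'S) · T_K²) = u₁ · (3^{v_K} · #Ш(V_K)[3^∞])` in `ℚ₃`
  have key : h0 * UU * (((tV : ℚ) : ℚ_[3]) * ((ϖ' * S : ℚ) : ℚ_[3]) * TK ^ 2) =
      ((u₁ : ℤ_[3]) : ℚ_[3]) * ((3 : ℚ_[3]) ^ vK * ShK) := by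
    apply mul_right_cancel₀ (pow_ne_zero 2 hNp0)
    have e1 : h0 * UU * (((tV : ℚ) : ℚ_[3]) * ((ϖ' * S : ℚ) : ℚ_[3]) * TK ^ 2) * Np ^ 2 =
        h0 * (a⁻¹ * (1 - a⁻¹) ^ 2 * ((tV : ℚ) : ℚ_[3]) * ((ϖ' * S : ℚ) : ℚ_[3])) * TK ^ 2 := by
      rw [h1, hUU]
      ring
    calc h0 * UU * (((tV : ℚ) : ℚ_[3]) * ((ϖ' * S : ℚ) : ℚ_[3]) * TK ^ 2) * Np ^ 2
        = h0 * (a⁻¹ * (1 - a⁻¹) ^ 2 * ((tV : ℚ) : ℚ_[3]) * ((ϖ' * S : ℚ) : ℚ_[3])) * TK ^ 2 := e1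
      _ = ((PowerSeries.constantCoeff fE : ℤ_[3]) : ℚ_[3]) * TK ^ 2 := by rw [← hfE0]
      _ = ((u₁ : ℤ_[3]) : ℚ_[3]) * (3 : ℚ_[3]) ^ vK * Np ^ 2 *
            (Nat.card (VK.selmerGroupPInfty 3) : ℚ_[3]) := by rw [hu₁]
      _ = ((u₁ : ℤ_[3]) : ℚ_[3]) * ((3 : ℚ_[3]) ^ vK * ShK) * Np ^ 2 := by rw [hSelK]; ring
  have h3K : (3 : ℚ_[3]) ^ vK * ShK ≠ 0 := mul_ne_zero (pow_ne_zero _ hp0) hShK0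
  have hRHS0 : ((u₁ : ℤ_[3]) : ℚ_[3]) * ((3 : ℚ_[3]) ^ vK * ShK) ≠ 0 :=
    mul_ne_zero (coe_units_ne_zero 3 u₁) h3K
  have hprod0 : ((tV : ℚ) : ℚ_[3]) * ((ϖ' * S : ℚ) : ℚ_[3]) * TK ^ 2 ≠ 0 :=
    mul_ne_zero (mul_ne_zero htVQ hϖSQ) (pow_ne_zero 2 hTK0)
  have hh0ne : h0 ≠ 0 := by
    intro h0'
    apply hRHS0
    rw [← key, h0', zero_mul, zero_mul]
  -- valuations of `key`
  have hva : a.valuation = 0 := by rw [haU]; exact valuation_coe_units_eq_zero 3 ua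
  have hvUU : UU.valuation = 0 := by
    rw [hUU, Padic.valuation_mul (inv_ne_zero ha0)
      (pow_ne_zero 2 (mul_ne_zero (coe_units_ne_zero 3 u₂) (coe_units_ne_zero 3 u₃))),
      Padic.valuation_inv, hva, Padic.valuation_pow,
      Padic.valuation_mul (coe_units_ne_zero 3 u₂) (coe_units_ne_zero 3 u₃),
      valuation_coe_units_eq_zero, valuation_coe_units_eq_zero]
    ring
  have hval := congrArg Padic.valuation key
  rw [Padic.valuation_mul (mul_ne_zero hh0ne hUU0) hprod0, Padic.valuation_mul hh0ne hUU0, hvUU,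
    Padic.valuation_mul (mul_ne_zero htVQ hϖSQ) (pow_ne_zero 2 hTK0), Padic.valuation_mul htVQ hϖSQ,
    Padic.valuation_pow, Padic.valuation_ratCast, Padic.valuation_ratCast,
    Padic.valuation_mul (coe_units_ne_zero 3 u₁) h3K, valuation_coe_units_eq_zero,
    Padic.valuation_mul (pow_ne_zero _ hp0) hShK0, Padic.valuation_pow] at hval
  have hv3 : (3 : ℚ_[3]).valuation = 1 := by
    have h := Padic.valuation_p (p := 3)
    exact_mod_cast h
  rw [hv3] at hval
  -- `v(T_K) = ord₃ #V(K)`, `v(Ш_K[3^∞]) = ord₃ #Ш(V_K)`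
  have hvTK : TK.valuation = (padicValNat 3 (Nat.card VK.toAffine.Point) : ℤ) := by
    rw [hTK, Padic.valuation_natCast, padicValNat_card_addPrimaryComponent 3]
  have hvShK : ShK.valuation = (padicValNat 3 VK.shaOrder : ℤ) := by
    rw [hShK, Padic.valuation_natCast, padicValNat_card_addPrimaryComponent 3]
    rfl
  rw [hvTK, hvShK] at hval
  -- (I'') the REVERSE of line V14's (I'): `ord₃ t_V + ord₃ (ϖ'S) + 2 ord₃ #V(K) ≤ v_K + ord₃ #Ш(V_K)`
  have hI : padicValRat 3 tV + padicValRat 3 (ϖ' * S) + 2 * padicValNat 3 (Nat.card VK.toAffine.Point) ≤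
      (vK : ℤ) + padicValNat 3 VK.shaOrder := by
    simp only [Nat.cast_ofNat] at hval; linarith
  -- Milne's identity in valuations (verbatim as in line V14)
  have hnV0 : ((V.baseChange ℝ).numRealComponents : ℚ) ≠ 0 := by
    rw [numRealComponents]; split_ifs <;> norm_num
  have hSV0 : (V.shaOrder : ℚ) ≠ 0 := by exact_mod_cast (V.shaOrder_pos hfinV).ne'
  have hSW0 : (W.shaOrder : ℚ) ≠ 0 := by exact_mod_cast (W.shaOrder_pos hfinW).ne'
  have hSK0 : (VK.shaOrder : ℚ) ≠ 0 := by exact_mod_cast (VK.shaOrder_pos hshaK).ne'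
  have hcV0 : (V.tamagawaProduct : ℚ) ≠ 0 := by exact_mod_cast V.tamagawaProduct_pos_holds.ne'
  have hcW0 : (W.tamagawaProduct : ℚ) ≠ 0 := by exact_mod_cast W.tamagawaProduct_pos_holds.ne'
  have hNV0 : ((Nat.card V.toAffine.Point : ℕ) : ℚ) ≠ 0 := by exact_mod_cast Nat.card_pos.ne'
  have hNW0 : ((Nat.card W.toAffine.Point : ℕ) : ℚ) ≠ 0 := by exact_mod_cast Nat.card_pos.ne'
  have hNK0 : ((Nat.card VK.toAffine.Point : ℕ) : ℚ) ≠ 0 := by exact_mod_cast Nat.card_pos.ne'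
  have hM0 : VK.modifiedTamagawaProduct ≠ 0 := modifiedTamagawaProduct_ne_zero VK
  have hvM : padicValRat 3 VK.modifiedTamagawaProduct = padicValNat 3 VK.tamagawaProduct :=
    padicValRat_modifiedTamagawaProduct_baseChange V 3
      (fun hdvd ↦ V.not_hasGoodReductionAtPrime_of_dvd_minimalDiscriminantInt 3 hdvd hord.1)
  have hvcard := hWR₃; rw [hVK] at hM0
  rw [padicValRat.mul (mul_ne_zero (mul_ne_zero hM0 hSK0) (pow_ne_zero 2 hNV0)) (pow_ne_zero 2 hNW0),
    padicValRat.mul (mul_ne_zero hM0 hSK0) (pow_ne_zero 2 hNV0), padicValRat.mul hM0 hSK0,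
    padicValRat.pow, padicValRat.pow,
    padicValRat.mul (mul_ne_zero (mul_ne_zero (mul_ne_zero (mul_ne_zero (mul_ne_zero hnV0 hua0) hSV0)
      hSW0) hcV0) hcW0) (pow_ne_zero 2 hNK0),
    padicValRat.mul (mul_ne_zero (mul_ne_zero (mul_ne_zero (mul_ne_zero hnV0 hua0) hSV0) hSW0) hcV0) hcW0,
    padicValRat.mul (mul_ne_zero (mul_ne_zero (mul_ne_zero hnV0 hua0) hSV0) hSW0) hcV0,
    padicValRat.mul (mul_ne_zero (mul_ne_zero hnV0 hua0) hSV0) hSW0,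
    padicValRat.mul (mul_ne_zero hnV0 hua0) hSV0, padicValRat.mul hnV0 hua0, padicValRat.pow,
    padicValRat_numRealComponents_eq_zero V 3 (by norm_num),
    padicValRat.of_nat, padicValRat.of_nat, padicValRat.of_nat, padicValRat.of_nat,
    padicValRat.of_nat, padicValRat.of_nat, padicValRat.of_nat, padicValRat.of_nat] at hvcard
  rw [← hVK] at hvcard; rw [hvM] at hvcard
  refine ⟨tV * (Nat.card V.toAffine.Point : ℚ) ^ 2 / (V.tamagawaProduct : ℚ),
    tW * (Nat.card W.toAffine.Point : ℚ) ^ 2 / (W.tamagawaProduct : ℚ), hshaV, hshaW, ?_⟩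
  rw [padicValRat.div (mul_ne_zero htV0 (pow_ne_zero 2 hNV0)) hcV0,
    padicValRat.mul htV0 (pow_ne_zero 2 hNV0), padicValRat.pow, padicValRat.of_nat, padicValRat.of_nat,
    padicValRat.div (mul_ne_zero htW0 (pow_ne_zero 2 hNW0)) hcW0,
    padicValRat.mul htW0 (pow_ne_zero 2 hNW0), padicValRat.pow, padicValRat.of_nat, padicValRat.of_nat,
    hvtW]
  push_cast at hI hvcard ⊢
  linarith

/-- **The rank-`(0,0)` ℚ(ζ₃) LOWER line with NO local-population hypothesis and NO `hMilne`**: the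
`_of_padicValIdentity` core with `Ш(V_K)` finite from `shaFinite_baseChange_of_twist` and the `3`-adic
card identity from T-MIL-CAN FILE 4's `padicVal_card_identity_baseChange_of_natAbs_discr_eq`
(`|d_K| = 3`, `V` good at `3`: the fibre identities (T) hold at EVERY place — n1011-p01's T-MIL-3
H-5a, rows T-MIL-B2 and T-A233 inside). Binder diff against the gen-2 line
`XGordRankZeroCyclotomicThreeLower…`: `hMilne` DELETED, nothing added; `hLowK` untouched.
[cite: GreenbergLNM1716, Thm. 4.1 (p. 102)] [cite: MazurTateTeitelbaum1986Invent, §I.14]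
[cite: Milne1972ArithmeticAV, §1 Thm. 1 and §2 (through DokchitserDokchitserAnnals2010, §2.1, proof of Thm. 8)]
[cite: Kato2004Asterisque, Thm. 17.4 (p. 273) (torsion clause)] -/
theorem XGordCyclotomicThreeLower.exists_padicVal_shaAn_add_le_noLocal
    (hGZK : rank_eq_analyticRank_of_analyticRank_le_one) (hmod : hasEntireLFunction_rat)
    (C : VariableChange ℚ) (hC : C • V.quadraticTwist (-(3 : ℚ)) = W)
    (hord : IsOrdinaryAt V 3) (hadd : Addv W 3)
    (hrV : V.analyticRank = 0) (hrW : W.analyticRank = 0)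
    {N : ℕ} [NeZero N] {f : CuspForm (Gamma0 N) 2} (hf : IsNewformOf V f)
    (ϖ ϖ' : ℚ) (hϖ : (ϖ : ℝ) * V.realPeriodRat = plusPeriod f)
    (hϖ' : (ϖ' : ℝ) * V.imaginaryPeriodRat = minusPeriod f)
    (hexK : ∃ κ : ZpExtension K 3, κ.IsCyclotomic ∧ ∃ γ : Field.absoluteGaloisGroup K,
      κ.IsTopGenerator γ ∧ ∃ ζ : ℤ_[3]ˣ, IsOfFinOrder ζ ∧
        ((GaloisRep.cyclotomicCharacter K 3 γ * ζ : ℤ_[3]ˣ) : ℤ_[3]) = (cyclotomicGenerator 3 : ℤ_[3]))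
    (hTorK : ∀ (κ : ZpExtension K 3) (γ : Field.absoluteGaloisGroup K),
      κ.IsCyclotomic → κ.IsTopGenerator γ →
      (∃ ζ : ℤ_[3]ˣ, IsOfFinOrder ζ ∧
        ((GaloisRep.cyclotomicCharacter K 3 γ * ζ : ℤ_[3]ˣ) : ℤ_[3]) = (cyclotomicGenerator 3 : ℤ_[3])) →
      ∀ D : (V.baseChange K).SelmerDualData κ γ, D.IsTorsion)
    (hLowK : ∀ (κ : ZpExtension K 3) (γ : Field.absoluteGaloisGroup K),
      κ.IsCyclotomic → κ.IsTopGenerator γ →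
      (∃ ζ : ℤ_[3]ˣ, IsOfFinOrder ζ ∧
        ((GaloisRep.cyclotomicCharacter K 3 γ * ζ : ℤ_[3]ˣ) : ℤ_[3]) = (cyclotomicGenerator 3 : ℤ_[3])) →
      ∀ D : (V.baseChange K).SelmerDualData κ γ, ∀ g ∈ D.charIdeal, ∃ h : IwasawaAlgebra 3,
        iwasawaToPowerSeries 3 g =
          iwasawaToPowerSeries 3 h *
            (PowerSeries.C ((ϖ : ℚ_[3]) * (ϖ' : ℚ_[3])) *
              (padicLFunction f ((unitRoot V 3 : ℤ_[3]) : ℚ_[3]) *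
                padicLFunctionMinusBranch f ((unitRoot V 3 : ℤ_[3]) : ℚ_[3]) 1)))
    (hGrK : ∀ (κ : ZpExtension K 3) (γ : Field.absoluteGaloisGroup K),
        κ.IsCyclotomic → κ.IsTopGenerator γ →
      ∀ (D : (V.baseChange K).SelmerDualData κ γ) [Module.Finite (IwasawaAlgebra 3) D.X], D.IsTorsion →
      ∀ (fE : IwasawaAlgebra 3), D.charIdeal = Ideal.span {fE} →
        Finite ((V.baseChange K).selmerGroupPInfty 3) →
        ∃ u : ℤ_[3]ˣ,
          ((PowerSeries.constantCoeff fE : ℤ_[3]) : ℚ_[3]) *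
              (Nat.card (AddCommGroup.primaryComponent (V.baseChange K).toAffine.Point 3) : ℚ_[3]) ^ 2 =
            ((u : ℤ_[3]) : ℚ_[3]) * (3 : ℚ_[3]) ^ (padicValNat 3 (V.baseChange K).tamagawaProduct) *
              (Nat.card (AddCommGroup.primaryComponent
                ((integralModelInt V).map (Int.castRingHom (ZMod 3))).toAffine.Point 3) : ℚ_[3]) ^ 2 *
              (Nat.card ((V.baseChange K).selmerGroupPInfty 3) : ℚ_[3]))
    (hD1 : PowerSeries.constantCoeff (padicLFunctionMinusBranch f ((unitRoot V 3 : ℤ_[3]) : ℚ_[3]) 1) =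
      (((unitRoot V 3 : ℤ_[3]) : ℚ_[3]))⁻¹ * (legendreMinusSymbolSum f 3 : ℚ_[3])) :
    ∃ qV qW : ℚ, shaAn V = (qV : ℂ) ∧ shaAn W = (qW : ℂ) ∧
      padicValRat 3 qV + padicValRat 3 qW ≤ (padicValNat 3 V.shaOrder : ℤ) + padicValNat 3 W.shaOrder := by
  haveI : Fact (Nat.Prime 3) := ⟨Nat.prime_three⟩
  have h2 : Module.finrank ℚ K = 2 := finrank_eq_two_of_isCyclotomicExtension_three (K := K)
  have hdK : NumberField.discr K = -3 := discr_cyclotomicThree K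
  have hC' : C • V.quadraticTwist (NumberField.discr K : ℚ) = W := by rw [hdK]; push_cast; exact hC
  have hdKabs : (NumberField.discr K).natAbs = 3 := by rw [hdK]; rfl
  obtain ⟨hmwV, hfinV⟩ := hGZK V (by rw [hrV]; exact zero_le_one)
  obtain ⟨hmwW, hfinW⟩ := hGZK W (by rw [hrW]; exact zero_le_one)
  haveI hEV : Finite V.toAffine.Point := V.finite_point_of_rank_zero (by rw [hmwV, hrV])
  haveI hEW : Finite W.toAffine.Point := W.finite_point_of_rank_zero (by rw [hmwW, hrW])
  haveI hEK : Finite (V.baseChange K).toAffine.Point := finite_point_baseChange_of_twist K V W h2 hC'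
  exact XGordCyclotomicThreeLower.exists_padicVal_shaAn_add_le_of_padicValIdentity K V W hGZK hmod C hC
    (shaFinite_baseChange_of_twist K V W h2 hC' hfinV hfinW)
    (padicVal_card_identity_baseChange_of_natAbs_discr_eq K V W 3 h2 hC' (by norm_num) hdKabs
      (Or.inl hord.1) hfinV hfinW)
    hord hadd hrV hrW hf ϖ ϖ' hϖ hϖ' hexK hTorK hLowK hGrK hD1

end Core

end Summit.BirchSwinnertonDyer.Rank1Residual.Additive
end
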